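import Mathlib.LinearAlgebra.Matrix.NonsingularInverse
import Mathlib.LinearAlgebra.Matrix.Rank
import Mathlib.RingTheory.Localization.Module
import Mathlib.RingTheory.MvPolynomial.Basic
import Mathlib.Algebra.MvPolynomial.Degrees
import HarnessLib

/-!
# A matrix with independent columns has a nonzero maximal minor; degree of minors

Linear-algebra input of Kaltofen's effective Hilbert irreducibility theorem in the form used by
Cafure–Matera (2006, proof of Thm. 3.3: "Let `Δ_D ∈ K[Z₂,…,Zₙ]` be a maximal nonzero minor of the
augmented matrix … Then … degree estimate"):

* `exists_det_submatrix_ne_zero`: over a domain `R`, a matrix `M` (rows `m`, columns `ι`) whose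
  columns are linearly independent has an injective choice of `|ι|` rows `f` with
  `det (M.submatrix f id) ≠ 0` (via the fraction field: row rank = column rank, and `|ι|`
  independent rows of a square matrix over a field make it invertible);
* `totalDegree_det_le_sum`: over `R = E[Z]`, if the entries of row `i` of a square matrix have total
  degree `≤ r i` then its determinant has total degree `≤ ∑ i, r i`;
* `exists_det_submatrix_ne_zero_totalDegree_le`: combining both for a matrix with rows indexed by
  `Fin k` and row `i` of degree `≤ i`: a nonzero maximal minor of degree `≤ |ι| (k - 1)`.

## References

* E. Kaltofen, J. Comput. System Sci. 50 (1995) 274–295, §3, proof of Thm. 5. [Kaltofen1995]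
* A. Cafure, G. Matera, Finite Fields Appl. 12 (2006) 155–185, proof of Thm. 3.3. [CafureMatera2006]
-/

noncomputable section

open scoped Classical
open Matrix

namespace Literature.NumberTheory.DiophantineGeometry

universe u v w

/-! ### Over a field: independent columns give an invertible maximal square submatrix -/

/-- Over a field, a matrix with linearly independent columns has `|ι|` rows forming an invertible
square submatrix. [folklore] -/
theorem exists_isUnit_submatrix_of_linearIndependent_cols {L : Type u} [Field L]
    {m : Type v} [Fintype m] {ι : Type w} [Fintype ι] (M : Matrix m ι L)
    (hM : LinearIndependent L M.col) :
    ∃ f : ι → m, Function.Injective f ∧ IsUnit (M.submatrix f id) := by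
  -- row rank = column rank = |ι|
  have hrank : M.rank = Fintype.card ι := by
    rw [rank_eq_finrank_span_cols, finrank_span_eq_card hM]
  have hrow : Module.finrank L (Submodule.span L (Set.range M.row)) = Fintype.card ι := by
    rw [← rank_eq_finrank_span_row, hrank]
  -- extract `|ι|` linearly independent rows
  obtain ⟨κ, a, ha, hspan, hli⟩ := exists_linearIndependent' (K := L) M.row
  haveI : Fintype κ := Fintype.ofInjective a ha
  have hcard : Fintype.card κ = Fintype.card ι := by
    rw [← hrow, ← hspan, finrank_span_eq_card hli]
  obtain ⟨e⟩ : Nonempty (ι ≃ κ) := Fintype.card_eq.1 hcard.symm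
  refine ⟨a ∘ e, ha.comp e.injective, ?_⟩
  rw [← linearIndependent_rows_iff_isUnit]
  have : (M.submatrix (a ∘ e) id).row = (M.row ∘ a) ∘ e := by
    funext j
    rfl
  rw [this]
  exact hli.comp e e.injective

/-! ### Over a domain: a nonzero maximal minor -/

/-- **A matrix with linearly independent columns over a domain has a nonzero maximal minor.**
[folklore] -/
theorem exists_det_submatrix_ne_zero {R : Type u} [CommRing R] [IsDomain R]
    {m : Type v} [Fintype m] {ι : Type w} [Fintype ι] (M : Matrix m ι R)
    (hM : LinearIndependent R M.col) :
    ∃ f : ι → m, Function.Injective f ∧ (M.submatrix f id).det ≠ 0 := by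
  set L := FractionRing R with hL
  set ML : Matrix m ι L := M.map (algebraMap R L) with hML
  -- the columns stay independent over the fraction field
  have hcol : ML.col = fun j ↦ (algebraMap R L) ∘ (M.col j) := by
    funext j i
    rfl
  have h1 : LinearIndependent R (fun j ↦ (algebraMap R L) ∘ (M.col j) : ι → m → L) := by
    have hker : LinearMap.ker ((Algebra.linearMap R L).compLeft m) = ⊥ := by
      rw [LinearMap.ker_eq_bot]
      intro x y hxy
      funext i
      exact IsFractionRing.injective R L (congrFun hxy i)
    have := hM.map' ((Algebra.linearMap R L).compLeft m) hker
    exact this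
  have h2 : LinearIndependent L ML.col := by
    rw [hcol]
    exact (LinearIndependent.iff_fractionRing R L).1 h1
  obtain ⟨f, hf, hu⟩ := exists_isUnit_submatrix_of_linearIndependent_cols ML h2
  refine ⟨f, hf, fun h0 ↦ ?_⟩
  have hdet : (ML.submatrix f id).det = algebraMap R L (M.submatrix f id).det := by
    rw [RingHom.map_det]
    rfl
  have hu' := (Matrix.isUnit_iff_isUnit_det _).1 hu
  rw [hdet, h0, map_zero] at hu'
  exact not_isUnit_zero hu'

/-! ### Degree of a determinant with row-wise degree bounds -/

/-- **Degree of a determinant, row-wise bound:** if the entries of row `i` of `N ∈ E[Z]^{ι×ι}`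
have total degree `≤ r i`, then `deg det N ≤ ∑ i, r i`. [folklore] -/
theorem totalDegree_det_le_sum {E : Type u} [CommRing E] {σ : Type v} {ι : Type w} [Fintype ι]
    (N : Matrix ι ι (MvPolynomial σ E)) (r : ι → ℕ) (hN : ∀ i j, (N i j).totalDegree ≤ r i) :
    N.det.totalDegree ≤ ∑ i, r i := by
  rw [Matrix.det_apply']
  refine MvPolynomial.totalDegree_finsetSum_le fun τ _ ↦ ?_
  refine (MvPolynomial.totalDegree_mul _ _).trans ?_
  have hsign : ((Equiv.Perm.sign τ : ℤ) : MvPolynomial σ E).totalDegree = 0 := by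
    rcases Int.units_eq_one_or (Equiv.Perm.sign τ) with h | h <;> simp [h]
  rw [hsign, zero_add]
  refine (MvPolynomial.totalDegree_finsetProd _ _).trans ?_
  calc ∑ i, (N (τ i) i).totalDegree ≤ ∑ i, r (τ i) := Finset.sum_le_sum fun i _ ↦ hN _ _
    _ = ∑ i, r i := Equiv.sum_comp τ r

/-- **A nonzero maximal minor of controlled degree.** Let `M ∈ E[Z]^{k × ι}` (`E` a field) have
linearly independent columns and entries of row `i` of total degree `≤ i`. Then some injective
choice `f` of `|ι|` rows gives a nonzero minor `det (M.submatrix f id)` of total degree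
`≤ |ι| (k - 1)`. [cite: CafureMatera2006, proof of Thm. 3.3] -/
theorem exists_det_submatrix_ne_zero_totalDegree_le {E : Type u} [Field E] {σ : Type v}
    {k : ℕ} {ι : Type w} [Fintype ι] (M : Matrix (Fin k) ι (MvPolynomial σ E))
    (hM : LinearIndependent (MvPolynomial σ E) M.col) (hdeg : ∀ i j, (M i j).totalDegree ≤ (i : ℕ)) :
    ∃ f : ι → Fin k, Function.Injective f ∧ (M.submatrix f id).det ≠ 0 ∧
      (M.submatrix f id).det.totalDegree ≤ Fintype.card ι * (k - 1) := by
  obtain ⟨f, hf, hdet⟩ := exists_det_submatrix_ne_zero M hM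
  refine ⟨f, hf, hdet, ?_⟩
  refine (totalDegree_det_le_sum (M.submatrix f id) (fun j ↦ (f j : ℕ)) (fun i j ↦ ?_)).trans ?_
  · exact hdeg (f i) j
  · calc ∑ j, (f j : ℕ) ≤ ∑ _j : ι, (k - 1) := Finset.sum_le_sum fun j _ ↦ by
          have := (f j).2; omega
      _ = Fintype.card ι * (k - 1) := by simp

end Literature.NumberTheory.DiophantineGeometry
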